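import Literature.Analysis.FluidPDE.PlanarTypedElements
import Literature.Analysis.FluidPDE.PlanarFrozenChain
import HarnessLib

/-!
# Typed chains with rational data: phases, their moving chains, element facts and box checks

Topic `Literature/Analysis/FluidPDE`. Level-4 data model, part 3 (after `PlanarPwProfiles.lean`,
`PlanarTypedElements.lean`, `PlanarFrozenChain.lean`). A **phase** of an explicit generator move is
emitted as ONE rational datum `P : PhaseQ`: a time slot (`clock P.t₀ P.τ`), the support radius `r₀`
of the transverse profile, and a list of **nodes**, each a typed element (`ElemQ`), its moving box
(`BoxQ`: four clock-affine edges and a transition length) and its out-junction step (`StepQ`: axis,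
sign, clock-affine breakpoint, transition length). Its semantics are the moving chain `P.chain`
(`PlanarMovingChain.lean`), the element fields `P.Θ G k`, `P.H k` and the element bands `P.Band k`.

The file proves, from Boolean tests on the data decidable by `decide +kernel`:

* `PhaseQ.facts`: the element facts `MovingChain.Facts` (joint smoothness, transport of every
  `Θ_k` by `∇⊥H_k` everywhere, the bound, band containment) from `elemsValidB` and the profile
  hypotheses (`G` smooth, `|G| ≤ M`, `G = 0` off `(-r₀, r₀)`);
* the box part of the diagonal well-formedness `MovingChain.WFBd` (`PlanarFrozenChain.lean`):
  positivity of the transition lengths (`allPosB`), smooth edges and breakpoints (always), closed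
  bands (always), and disjointness of the support boxes of non-consecutive elements at every time
  from ONE separating direction per pair valid at both clock endpoints (`allSepB`, affine in
  between); the three ORDER conditions are isolated as the proposition `PhaseQ.Orders` (discharged
  by the geometric checks of the sequel), and `PhaseQ.wfbd` assembles `WFBd`.

Folklore; no named facts. Infrastructure towards a discharge of `acm_compatible_blocks`
(`QuasiSelfSimilarCompatibleBlocks.lean`).

## References

* G. Alberti, G. Crippa, A. L. Mazzucato, *Exponential self-similar mixing by incompressible
  flows*, J. Amer. Math. Soc. 32 (2019), 445–490, §§7–8 (arXiv:1605.02090).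
-/

noncomputable section

open Function Set Filter
open scoped Topology ContDiff

namespace Literature.Analysis.FluidPDE

namespace PlanarKinematics

open Gluing

/-- The plane `ℝ²` as a Euclidean space. [folklore] -/
local notation "E²" => EuclideanSpace ℝ (Fin 2)

/-! ## Moving boxes with rational data -/

/-- **Rational moving box**: clock-affine edges `a₀ b₀ a₁ b₁` and a transition length `ρ`. [folklore] -/
structure BoxQ where
  /-- left edge, axis `0` -/
  a₀ : Aff
  /-- right edge, axis `0` -/
  b₀ : Aff
  /-- lower edge, axis `1` -/
  a₁ : Aff
  /-- upper edge, axis `1` -/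
  b₁ : Aff
  /-- transition length -/
  ρ : ℚ
deriving DecidableEq, Inhabited

namespace BoxQ

variable (B : BoxQ)

/-- The box plateau at clock value `α`. [folklore] -/
def frzAt (α : ℝ) : BoxPlateau := ⟨B.a₀.eval α, B.b₀.eval α, B.a₁.eval α, B.b₁.eval α, B.ρ⟩

/-- The moving box driven by the clock `clock t₀ τ`. [folklore] -/
def moving (t₀ τ : ℝ) : MovingBox :=
  ⟨fun t => B.a₀.eval (clock t₀ τ t), fun t => B.b₀.eval (clock t₀ τ t), fun t => B.a₁.eval (clock t₀ τ t),
    fun t => B.b₁.eval (clock t₀ τ t), B.ρ⟩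

/-- Freezing the moving box gives the box at the clock value. [folklore] -/
@[simp] theorem moving_frz (t₀ τ t : ℝ) : (B.moving t₀ τ).frz t = B.frzAt (clock t₀ τ t) := rfl

/-- The transition length of the frozen box. [folklore] -/
@[simp] theorem frzAt_ρ (α : ℝ) : (B.frzAt α).ρ = B.ρ := rfl

/-- **The moving box has smooth edges.** [folklore] -/
theorem moving_smooth (t₀ τ : ℝ) : (B.moving t₀ τ).Smooth :=
  ⟨(B.a₀.contDiff_eval).comp (clock_contDiff t₀ τ), (B.b₀.contDiff_eval).comp (clock_contDiff t₀ τ),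
    (B.a₁.contDiff_eval).comp (clock_contDiff t₀ τ), (B.b₁.contDiff_eval).comp (clock_contDiff t₀ τ)⟩

/-- **Separation test** of two moving boxes: one of the four directions separates the support
boxes at both clock endpoints. [folklore] -/
def sepB (p q : BoxQ) : Bool :=
  Aff.ltB (p.b₀.sub (Aff.const (p.ρ / 3))) (q.a₀.add (Aff.const (q.ρ / 3))) ||
    Aff.ltB (q.b₀.sub (Aff.const (q.ρ / 3))) (p.a₀.add (Aff.const (p.ρ / 3))) ||
    Aff.ltB (p.b₁.sub (Aff.const (p.ρ / 3))) (q.a₁.add (Aff.const (q.ρ / 3))) ||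
    Aff.ltB (q.b₁.sub (Aff.const (q.ρ / 3))) (p.a₁.add (Aff.const (p.ρ / 3)))

/-- **Soundness of the separation test**: separated moving boxes have disjoint support boxes at
every clock value in `[0,1]`. [folklore] -/
theorem not_mem_supp_of_sepB {p q : BoxQ} (h : sepB p q = true) {α : ℝ} (hα : α ∈ Icc (0 : ℝ) 1) (z : E²)
    (hz : z ∈ (p.frzAt α).supp) : z ∉ (q.frzAt α).supp := by
  intro hz'
  obtain ⟨h1, h2, h3, h4⟩ := hz
  obtain ⟨h1', h2', h3', h4'⟩ := hz'
  simp only [BoxQ.frzAt] at h1 h2 h3 h4 h1' h2' h3' h4'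
  simp only [sepB, Bool.or_eq_true] at h
  rcases h with ((hs | hs) | hs) | hs <;>
  · have e := Aff.eval_lt_eval hs hα
    simp only [Aff.eval_sub, Aff.eval_add, Aff.eval_const] at e
    push_cast at e
    linarith

/-- **All-pairs separation test**: every two boxes of the list at index distance `≥ 2` are
separated (quadratic, by recursion on the list). [folklore] -/
def allSepB : List BoxQ → Bool
  | [] => true
  | b :: rest => (rest.drop 1).all (sepB b) && allSepB rest

/-- An element of index `≥ n` lies in `drop n`. [folklore] -/
theorem getElem_mem_drop {α : Type*} (l : List α) {n i : ℕ} (hni : n ≤ i) (hi : i < l.length) : l[i] ∈ l.drop n := by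
  have h : (l.drop n)[i - n]'(by simp; omega) = l[i] := by
    rw [List.getElem_drop]; congr 1; omega
  rw [← h]; exact List.getElem_mem _

/-- **Soundness of the all-pairs test** (index form). [folklore] -/
theorem sepB_of_allSepB : ∀ (L : List BoxQ), allSepB L = true →
    ∀ (j k : ℕ) (hj : j < L.length) (hk : k < L.length), j + 2 ≤ k → sepB L[j] L[k] = true
  | [], _, j, _, hj, _, _ => absurd hj (by simp)
  | b :: rest, h, 0, k, _, hk, hjk => by
    simp only [allSepB, Bool.and_eq_true, List.all_eq_true] at h
    have hk' : k - 1 < rest.length := by simp at hk; omega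
    have e : (b :: rest)[k] = rest[k - 1] := by
      rw [List.getElem_cons]; rw [dif_neg (by omega)]
    rw [e]
    exact h.1 _ (getElem_mem_drop rest (by omega) hk')
  | b :: rest, h, j + 1, k, hj, hk, hjk => by
    simp only [allSepB, Bool.and_eq_true] at h
    have hj' : j < rest.length := by simp at hj; omega
    have hk' : k - 1 < rest.length := by simp at hk; omega
    have e1 : (b :: rest)[j + 1] = rest[j] := List.getElem_cons_succ ..
    have e2 : (b :: rest)[k] = rest[k - 1] := by
      rw [List.getElem_cons]; rw [dif_neg (by omega)]
    rw [e1, e2]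
    exact sepB_of_allSepB rest h.2 j (k - 1) hj' hk' (by omega)

end BoxQ

/-! ## Junction steps with rational data -/

/-- **Rational junction step**: lab axis, sign, clock-affine breakpoint, transition length. [folklore] -/
structure StepQ where
  /-- the axis of the argument -/
  axis : Fin 2
  /-- orientation (`±1`) -/
  sgn : ℚ
  /-- breakpoint (clock-affine) -/
  pos : Aff
  /-- transition length -/
  len : ℚ
deriving DecidableEq, Inhabited

namespace StepQ

/-- The junction step driven by the clock. [folklore] -/
def toJ (J : StepQ) (t₀ τ : ℝ) : JStep := ⟨J.axis, J.sgn, fun t => J.pos.eval (clock t₀ τ t), J.len⟩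

/-- Its breakpoint is smooth. [folklore] -/
theorem toJ_pos_contDiff (J : StepQ) (t₀ τ : ℝ) : ContDiff ℝ ∞ (J.toJ t₀ τ).pos :=
  (J.pos.contDiff_eval).comp (clock_contDiff t₀ τ)

/-- Its argument. [folklore] -/
theorem toJ_arg (J : StepQ) (t₀ τ t : ℝ) (z : E²) :
    (J.toJ t₀ τ).arg t z = J.sgn * (z J.axis - J.pos.eval (clock t₀ τ t)) / J.len := rfl

end StepQ

/-! ## Annotations (geometric certificates supplied by the emitter, verified by the sequel) -/

/-- **Regime of a band piece**: `flat` (a run: the line is the transverse line), `gap m` (the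
profile is exactly affine: the first `m` kinks passed, the others not begun), `trans m` (the first
`m` kinks passed, kink `m` anywhere up to the end of its transition). [folklore] -/
inductive RegQ
  /-- run: constant line -/
  | flat
  /-- exact gap `m` of the profile -/
  | gap (m : ℕ)
  /-- up to the end of the transition of kink `m` -/
  | trans (m : ℕ)
deriving DecidableEq, Inhabited

/-- **Band piece**: a `u`-interval of the element's frame abscissa, the regimes of the profile and
of the material map on it, and a tag naming the cover case claimed on it (`0` core, `1` in-junction,
`2` out-junction, …). [folklore] -/
structure PieceQ where
  /-- lower end of the `u`-interval -/
  ua : Aff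
  /-- upper end of the `u`-interval -/
  ub : Aff
  /-- regime of the profile on the interval -/
  reg : RegQ
  /-- dominating gaps of the material map on the interval: the slope `Ξᵤ` is bounded there by the
  largest of the gap slopes `W m`, `m ∈ regXi` (empty list: only the global bound `whi` is used) -/
  regXi : List ℕ
  /-- cover case tag -/
  tag : ℕ
deriving DecidableEq, Inhabited

/-- **Kind of the out-junction** of a node: `identical` (the next element carries the same element
datum: sub-elements of one run, the five elements of a birth), or `forms` (a genuine junction on a
rigid zone: the regimes `mT, mΞ` of this element and `mT', mΞ'` of the next one, and the zone as a
`u`-interval in each of the two frames). [folklore] -/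
inductive JKindQ
  /-- same element datum -/
  | identical
  /-- junction of affine forms on a rigid zone -/
  | forms (mT mΞ mT' mΞ' : ℕ) (za zb za' zb' : Aff)
deriving DecidableEq, Inhabited

/-- **Annotation of a node**: the `u`-clip of its band inside its support box with the support
edges certifying it (`0`: `x ≥ lo`, `1`: `x ≤ hi`, `2`: `y ≥ lo`, `3`: `y ≤ hi` is the violated
constraint beyond the clip), the band pieces, and the kind of the out-junction. [folklore] -/
structure AnnQ where
  /-- lower `u`-clip -/
  uIn : Aff
  /-- upper `u`-clip -/
  uOut : Aff
  /-- support edge crossed below `uIn` -/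
  edgeIn : Fin 4
  /-- support edge crossed above `uOut` -/
  edgeOut : Fin 4
  /-- band pieces -/
  pieces : List PieceQ
  /-- kind of the out-junction -/
  jkind : JKindQ
deriving DecidableEq, Inhabited

/-! ## Tight bands of the elements -/

namespace ElemQ

/-- **Tight band of a run**: `|(A z)₁ - y(t)| ≤ r₀ · Ξₓ(t, (A z)₀)`. [folklore] -/
def bandT (e : ElemQ) (t₀ τ r₀ : ℝ) : Set (ℝ × E²) :=
  match e with
  | run r => {p | |(d4Frame r.o).app p.2 1 - r.yF t₀ τ p.1| ≤ r₀ * r.Ξ.cdu t₀ τ p.1 ((d4Frame r.o).app p.2 0)}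
  | dg d => {p | |(diagFrame ((d4Frame d.o).app p.2)) 1 - d.T.cval t₀ τ p.1 ((diagFrame ((d4Frame d.o).app p.2)) 0)| ≤
      r₀ * d.Ξ.cdu t₀ τ p.1 ((diagFrame ((d4Frame d.o).app p.2)) 0)}

/-- **The tight band is closed.** [folklore] -/
theorem isClosed_bandT (e : ElemQ) (t₀ τ r₀ : ℝ) : IsClosed (e.bandT t₀ τ r₀) := by
  cases e with
  | run r =>
    have hA : Continuous fun p : ℝ × E² => (d4Frame r.o).app p.2 :=
      ((d4Frame r.o).contDiff_app (n := 0)).continuous.comp continuous_snd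
    have h1 : Continuous fun p : ℝ × E² => (d4Frame r.o).app p.2 1 := (EuclideanSpace.proj (1 : Fin 2)).continuous.comp hA
    have h0 : Continuous fun p : ℝ × E² => (d4Frame r.o).app p.2 0 := (EuclideanSpace.proj (0 : Fin 2)).continuous.comp hA
    have h2 : Continuous fun p : ℝ × E² => r.yF t₀ τ p.1 :=
      (RunQ.yF_contDiff (r := r) (t₀ := t₀) (τ := τ)).continuous.comp continuous_fst
    have hc : Continuous (uncurry (r.Ξ.cdu t₀ τ)) := (Pw.contDiff_uncurry_cdu (F := r.Ξ) (t₀ := t₀) (τ := τ)).continuous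
    have h3 : Continuous fun p : ℝ × E² => r.Ξ.cdu t₀ τ p.1 ((d4Frame r.o).app p.2 0) := hc.comp₂ continuous_fst h0
    exact isClosed_le ((h1.sub h2).abs) (continuous_const.mul h3)
  | dg d =>
    have hA : Continuous fun p : ℝ × E² => diagFrame ((d4Frame d.o).app p.2) :=
      (contDiff_diagFrame (n := 0)).continuous.comp (((d4Frame d.o).contDiff_app (n := 0)).continuous.comp continuous_snd)
    have h1 : Continuous fun p : ℝ × E² => (diagFrame ((d4Frame d.o).app p.2)) 1 := (EuclideanSpace.proj (1 : Fin 2)).continuous.comp hA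
    have h0 : Continuous fun p : ℝ × E² => (diagFrame ((d4Frame d.o).app p.2)) 0 := (EuclideanSpace.proj (0 : Fin 2)).continuous.comp hA
    have hT : Continuous (uncurry (d.T.cval t₀ τ)) := (Pw.contDiff_uncurry_cval (F := d.T) (t₀ := t₀) (τ := τ)).continuous
    have h2 : Continuous fun p : ℝ × E² => d.T.cval t₀ τ p.1 ((diagFrame ((d4Frame d.o).app p.2)) 0) := hT.comp₂ continuous_fst h0
    have hc : Continuous (uncurry (d.Ξ.cdu t₀ τ)) := (Pw.contDiff_uncurry_cdu (F := d.Ξ) (t₀ := t₀) (τ := τ)).continuous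
    have h3 : Continuous fun p : ℝ × E² => d.Ξ.cdu t₀ τ p.1 ((diagFrame ((d4Frame d.o).app p.2)) 0) := hc.comp₂ continuous_fst h0
    exact isClosed_le ((h1.sub h2).abs) (continuous_const.mul h3)

/-- **Tight band containment**: if `G` vanishes off `(-r₀, r₀)`, the scalar of a valid element is nonzero
only on its tight band. [folklore] -/
theorem mem_bandT_of_scalar_ne_zero (e : ElemQ) {G : ℝ → ℝ} {t₀ τ r₀ : ℝ} (hG0 : ∀ q, G q ≠ 0 → |q| < r₀)
    (hv : e.validB = true) {p : ℝ × E²} (hne : e.scalar t₀ τ G p.1 p.2 ≠ 0) : p ∈ e.bandT t₀ τ r₀ := by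
  cases e with
  | run r =>
    have hval : (run r).scalar t₀ τ G p.1 p.2 =
        G (((d4Frame r.o).app p.2 1 - r.yF t₀ τ p.1) / r.Ξ.cdu t₀ τ p.1 ((d4Frame r.o).app p.2 0)) := by
      rw [scalar, RunQ.scalar, LinFrame.conjScalar_apply, runScalar_apply]
    rw [hval] at hne
    have hq := hG0 _ hne
    have hpos := Pw.cdu_pos (t₀ := t₀) (τ := τ) (F := r.Ξ) hv p.1 ((d4Frame r.o).app p.2 0)
    rw [abs_div, abs_of_pos hpos, div_lt_iff₀ hpos] at hq
    exact hq.le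
  | dg d =>
    have hm := DgQ.matValid_of_validB hv
    have hval : (dg d).scalar t₀ τ G p.1 p.2 =
        G (((diagFrame ((d4Frame d.o).app p.2)) 1 - d.T.cval t₀ τ p.1 ((diagFrame ((d4Frame d.o).app p.2)) 0)) /
          d.Ξ.cdu t₀ τ p.1 ((diagFrame ((d4Frame d.o).app p.2)) 0)) := by
      rw [scalar, DgQ.scalar, LinFrame.conjScalar_apply, cornerScalar, graphPullback_apply, vec2_apply_one]
    rw [hval] at hne
    have hq := hG0 _ hne
    have hpos := Pw.cdu_pos (t₀ := t₀) (τ := τ) (F := d.Ξ) hm p.1 ((diagFrame ((d4Frame d.o).app p.2)) 0)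
    rw [abs_div, abs_of_pos hpos, div_lt_iff₀ hpos] at hq
    exact hq.le

end ElemQ

/-! ## Nodes and phases -/

/-- **Node**: a typed element with its moving box, its out-junction step and its annotation. [folklore] -/
structure NodeQ where
  /-- the element -/
  e : ElemQ
  /-- its moving box -/
  box : BoxQ
  /-- its out-junction step (unused for the last element) -/
  step : StepQ
  /-- its annotation (certificates checked by the sequel; no semantics here) -/
  ann : AnnQ
deriving DecidableEq, Inhabited

/-- **Phase**: time slot `clock t₀ τ`, profile support radius `r₀`, and the nodes in chain order.
[folklore] -/
structure PhaseQ where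
  /-- start of the clock transition window -/
  t₀ : ℚ
  /-- length of the clock window (`> 0`) -/
  τ : ℚ
  /-- support radius of the transverse profile: `G q ≠ 0 → |q| < r₀` -/
  r₀ : ℚ
  /-- the nodes -/
  nodes : List NodeQ
deriving DecidableEq, Inhabited

namespace PhaseQ

variable (P : PhaseQ)

/-- Number of elements. [folklore] -/
def K : ℕ := P.nodes.length

/-- Node `k` (default beyond the list). [folklore] -/
def node (k : ℕ) : NodeQ := P.nodes.getD k default

/-- The clock parameters as reals. [folklore] -/
def T0 : ℝ := P.t₀

/-- The clock parameters as reals. [folklore] -/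
def Tau : ℝ := P.τ

/-- **The moving chain of a phase.** [folklore] -/
def chain : MovingChain := ⟨P.K, fun k => (P.node k).box.moving P.T0 P.Tau, fun j => (P.node j).step.toJ P.T0 P.Tau⟩

/-- **The element scalars** (profile `G`). [folklore] -/
def Θ (G : ℝ → ℝ) : ℕ → ℝ → E² → ℝ := fun k => (P.node k).e.scalar P.T0 P.Tau G

/-- **The element stream functions.** [folklore] -/
def H : ℕ → ℝ → E² → ℝ := fun k => (P.node k).e.stream P.T0 P.Tau

/-- **The element bands** (tight: `|v - line| ≤ r₀ Ξᵤ`). [folklore] -/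
def Band : ℕ → Set (ℝ × E²) := fun k => (P.node k).e.bandT P.T0 P.Tau P.r₀

/-- Fields of the chain. [folklore] -/
@[simp] theorem chain_K : P.chain.K = P.K := rfl

/-- Fields of the chain. [folklore] -/
@[simp] theorem chain_box (k : ℕ) : P.chain.box k = (P.node k).box.moving P.T0 P.Tau := rfl

/-- Fields of the chain. [folklore] -/
@[simp] theorem chain_J (j : ℕ) : P.chain.J j = (P.node j).step.toJ P.T0 P.Tau := rfl

/-- A node of index `< K` is a member of the node list. [folklore] -/
theorem node_mem {k : ℕ} (hk : k < P.K) : P.node k ∈ P.nodes := by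
  have hk' : k < P.nodes.length := hk
  rw [node, List.getD_eq_getElem?_getD, List.getElem?_eq_getElem hk', Option.getD_some]
  exact List.getElem_mem hk'

/-- A node of index `< K` is the list entry. [folklore] -/
theorem node_eq_getElem {k : ℕ} (hk : k < P.K) : P.node k = P.nodes[k]'hk := by
  have hk' : k < P.nodes.length := hk
  rw [node, List.getD_eq_getElem?_getD, List.getElem?_eq_getElem hk', Option.getD_some]
  rfl

/-! ### Element facts from validity -/

/-- **Validity test of the elements and the clock**: every element valid, `τ > 0`. [folklore] -/
def elemsValidB : Bool := (P.nodes.all fun n => n.e.validB) && decide (0 < P.τ)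

variable {P}

/-- A valid phase has a positive clock window. [folklore] -/
theorem Tau_pos (hv : P.elemsValidB = true) : 0 < P.Tau := by
  simp only [elemsValidB, Bool.and_eq_true, decide_eq_true_eq] at hv
  show (0 : ℝ) < (P.τ : ℝ)
  exact_mod_cast hv.2

/-- A valid phase has a nonzero clock window. [folklore] -/
theorem Tau_ne_zero (hv : P.elemsValidB = true) : P.Tau ≠ 0 := (Tau_pos hv).ne'

/-- Every element of a valid phase is valid. [folklore] -/
theorem validB_node (hv : P.elemsValidB = true) {k : ℕ} (hk : k < P.K) : (P.node k).e.validB = true := by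
  simp only [elemsValidB, Bool.and_eq_true, List.all_eq_true] at hv
  exact hv.1 _ (P.node_mem hk)

/-- **Element facts of a valid phase**: smooth fields, transport of every `Θ_k` by `∇⊥H_k`
everywhere, the bound and band containment — from the Boolean validity and the profile
hypotheses. [folklore] -/
theorem facts {G : ℝ → ℝ} {M : ℝ} (hG : ContDiff ℝ ∞ G) (hM : ∀ q, |G q| ≤ M) (hM0 : 0 ≤ M)
    (hG0 : ∀ q, G q ≠ 0 → |q| < P.r₀) (hv : P.elemsValidB = true) : P.chain.Facts (P.Θ G) P.H M P.Band where
  smooth_scalar _ hk := ElemQ.contDiff_uncurry_scalar hG (validB_node hv hk)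
  smooth_stream _ hk := ElemQ.contDiff_uncurry_stream (Tau_ne_zero hv) (validB_node hv hk)
  transport _ hk t z := ElemQ.transport hG (Tau_ne_zero hv) (validB_node hv hk) t z
  abs_le _ _ t z := ElemQ.abs_scalar_le hM t z
  M_nonneg := hM0
  band _ hk _ hne := ElemQ.mem_bandT_of_scalar_ne_zero _ hG0 (validB_node hv hk) hne

/-! ### The box part of the diagonal well-formedness -/

variable (P)

/-- **Positivity test of the box transition lengths and of the step lengths.** [folklore] -/
def allPosB : Bool := P.nodes.all fun n => decide (0 < n.box.ρ) && decide (0 < n.step.len)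

/-- **All-pairs separation test of the boxes.** [folklore] -/
def boxSepB : Bool := BoxQ.allSepB (P.nodes.map fun n => n.box)

/-- **The order conditions of a phase** (the three order fields of `ChainData.WFB` for every fully
frozen chain), isolated as a proposition; they are discharged by the geometric checks of the
sequel. [folklore] -/
structure Orders : Prop where
  /-- forward order on the overlap with the predecessor's inner box -/
  fwd : ∀ (s : ℝ) (k : ℕ), k + 1 < P.K → ∀ (t : ℝ) (z : E²), z ∈ ((P.chain.frozenAt s).B (k + 1)).supp →
    z ∈ ((P.chain.frozenAt s).B k).inner → (P.chain.frozenAt s).sigmaOut k t z = 0 →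
      (P.chain.frozenAt s).sigmaOut (k + 1) t z = 0
  /-- backward order on the overlap with the successor's inner box -/
  bwd : ∀ (s : ℝ) (k : ℕ), k + 1 < P.K → ∀ (t : ℝ) (z : E²), z ∈ ((P.chain.frozenAt s).B k).supp →
    z ∈ ((P.chain.frozenAt s).B (k + 1)).inner → (P.chain.frozenAt s).sigmaOut k t z = 1 →
      (P.chain.frozenAt s).sigmaIn k t z = 1
  /-- order on the band -/
  band : ∀ (s : ℝ) (k : ℕ), k < P.K → ∀ (t : ℝ) (z : E²), z ∈ ((P.chain.frozenAt s).B k).supp →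
    (t, z) ∈ MovingChain.bandSlice P.Band s k → 0 < (P.chain.frozenAt s).sigmaOut k t z →
      (P.chain.frozenAt s).sigmaIn k t z = 1

variable {P}

/-- Positive transition lengths of the boxes. [folklore] -/
theorem box_ρ_pos (h : P.allPosB = true) {k : ℕ} (hk : k < P.K) : 0 < ((P.node k).box.ρ : ℝ) := by
  simp only [allPosB, List.all_eq_true, Bool.and_eq_true, decide_eq_true_eq] at h
  exact_mod_cast (h _ (P.node_mem hk)).1

/-- Positive transition lengths of the steps. [folklore] -/
theorem step_len_pos (h : P.allPosB = true) {k : ℕ} (hk : k < P.K) : 0 < ((P.node k).step.len : ℝ) := by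
  simp only [allPosB, List.all_eq_true, Bool.and_eq_true, decide_eq_true_eq] at h
  exact_mod_cast (h _ (P.node_mem hk)).2

/-- The boxes of the fully frozen chain at time `s` are the rational boxes at the clock value. [folklore] -/
theorem frozenAt_B (s : ℝ) (k : ℕ) : (P.chain.frozenAt s).B k = (P.node k).box.frzAt (clock P.T0 P.Tau s) := rfl

/-- **Disjointness of the support boxes at every time**, from the all-pairs test. [folklore] -/
theorem disjoint_of_boxSepB (h : P.boxSepB = true) (s : ℝ) :
    ∀ j < P.K, ∀ k < P.K, j + 2 ≤ k → ∀ z : E², z ∈ ((P.chain.frozenAt s).B j).supp → z ∉ ((P.chain.frozenAt s).B k).supp := by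
  intro j hj k hk hjk z hz
  rw [frozenAt_B] at hz ⊢
  have hj' : j < (P.nodes.map fun n => n.box).length := by rw [List.length_map]; exact hj
  have hk' : k < (P.nodes.map fun n => n.box).length := by rw [List.length_map]; exact hk
  have hs := BoxQ.sepB_of_allSepB _ h j k hj' hk' hjk
  simp only [List.getElem_map] at hs
  rw [P.node_eq_getElem hj] at hz
  rw [P.node_eq_getElem hk]
  exact BoxQ.not_mem_supp_of_sepB hs (clock_mem_Icc _ _ s) z hz

/-- **Band slices are closed.** [folklore] -/
theorem isClosed_bandSlice (s : ℝ) (k : ℕ) : IsClosed (MovingChain.bandSlice P.Band s k) := by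
  have hc : Continuous fun p : ℝ × E² => ((s, p.2) : ℝ × E²) := continuous_const.prodMk continuous_snd
  exact (ElemQ.isClosed_bandT (P.node k).e P.T0 P.Tau P.r₀).preimage hc

/-- **The fully frozen chain of a checked phase is banded well-formed** (given the order conditions).
[folklore] -/
theorem frozenAt_wfb (hpos : P.allPosB = true) (hsep : P.boxSepB = true) (ho : P.Orders) (s : ℝ) :
    (P.chain.frozenAt s).WFB (MovingChain.bandSlice P.Band s) where
  ρ_pos _ hk := box_ρ_pos hpos hk
  pos_smooth _ _ := contDiff_const
  disjoint := disjoint_of_boxSepB hsep s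
  order_fwd k hk t z := ho.fwd s k hk t z
  order_bwd k hk t z := ho.bwd s k hk t z
  isClosed_band k _ := isClosed_bandSlice s k
  order_band k hk t z := ho.band s k hk t z

/-- **Diagonal well-formedness of a checked phase** (given the order conditions). [folklore] -/
theorem wfbd (hpos : P.allPosB = true) (hsep : P.boxSepB = true) (ho : P.Orders) : P.chain.WFBd P.Band where
  frozenAt s := frozenAt_wfb hpos hsep ho s
  smooth _ _ := BoxQ.moving_smooth _ P.T0 P.Tau
  pos_smooth _ _ := StepQ.toJ_pos_contDiff _ P.T0 P.Tau
  isClosed_band _ _ := ElemQ.isClosed_bandT _ P.T0 P.Tau P.r₀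

/-! ### The move of a phase -/

/-- **The assembled scalar of a phase** (profile `G`). [folklore] -/
def scalar (P : PhaseQ) (G : ℝ → ℝ) : ℝ → E² → ℝ := assembledScalar P.K P.chain.chi (P.Θ G)

/-- **The assembled stream function of a phase** (reference stream `0`). [folklore] -/
def stream (P : PhaseQ) : ℝ → E² → ℝ := assembledStream P.K 0 P.chain.chi P.H

/-- **The assembled velocity of a phase.** [folklore] -/
def velocity (P : PhaseQ) : ℝ → E² → E² := assembledVelocity P.K 0 P.chain.chi P.H

/-- The assembled scalar of a valid, well-formed phase is smooth. [folklore] -/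
theorem contDiff_uncurry_scalar {G : ℝ → ℝ} {M : ℝ} (hG : ContDiff ℝ ∞ G) (hM : ∀ q, |G q| ≤ M) (hM0 : 0 ≤ M)
    (hG0 : ∀ q, G q ≠ 0 → |q| < P.r₀) (hv : P.elemsValidB = true) (hw : P.chain.WFBd P.Band) :
    ContDiff ℝ ∞ (uncurry (P.scalar G)) :=
  hw.contDiff_uncurry_scalar (facts hG hM hM0 hG0 hv)

/-- The assembled velocity of a valid, well-formed phase is smooth. [folklore] -/
theorem contDiff_uncurry_velocity {G : ℝ → ℝ} {M : ℝ} (hG : ContDiff ℝ ∞ G) (hM : ∀ q, |G q| ≤ M) (hM0 : 0 ≤ M)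
    (hG0 : ∀ q, G q ≠ 0 → |q| < P.r₀) (hv : P.elemsValidB = true) (hw : P.chain.WFBd P.Band) :
    ContDiff ℝ ∞ (uncurry P.velocity) :=
  hw.contDiff_uncurry_velocity (H₀ := 0) (facts hG hM hM0 hG0 hv)

/-- The assembled velocity of a valid, well-formed phase is divergence free everywhere. [folklore] -/
theorem divergence_velocity {G : ℝ → ℝ} {M : ℝ} (hG : ContDiff ℝ ∞ G) (hM : ∀ q, |G q| ≤ M) (hM0 : 0 ≤ M)
    (hG0 : ∀ q, G q ≠ 0 → |q| < P.r₀) (hv : P.elemsValidB = true) (hw : P.chain.WFBd P.Band) (t : ℝ) (z : E²) :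
    ∑ j, fderiv ℝ (P.velocity t) z (EuclideanSpace.single j 1) j = 0 :=
  hw.divergence_velocity (H₀ := 0) (facts hG hM hM0 hG0 hv) t z

end PhaseQ

end PlanarKinematics

end Literature.Analysis.FluidPDE
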